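import Mathlib

/-!
# SoloBlindE13Pencil — the divisibility step (α) of THEOREM E13-THIRTEEN (solo-blind s139)

On the critical stratum `e = 1/3` of WILD88 the satellite scheme of a cluster is the plane
complete intersection `V = V(a⁵ − P_a, b⁵ − P_b)` with `deg P ≤ 2`, and the first `ũ`-dependent
order of the node functional is represented on `V` by a cubic whose cubic part is
`−τ² · a b (a + b)`.  Bézout and Cayley–Bacharach for the `(3,5)` complete intersection reduce the
uniform fibre bound `≤ 13` (hence `≤ 6 × 13 = 78 ≤ 92` wild nodes per vertex) to the fact that no
nonzero pencil member — its degree-5 part is `c₁ a⁵ + c₂ b⁵` — is divisible by that cubic.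
Restricted to the line at infinity this is the elementary statement proved here:
`c₁ a⁵ + c₂ b⁵ = A · (a b (a + b))` in `K[a,b]` forces `c₁ = c₂ = 0` (evaluate at `(1,0)` and
`(0,1)`), stated over any commutative ring, together with the corollary that a pencil member with
some `cᵢ ≠ 0` is never a multiple of the cubic part (this is also what makes Bézout applicable: no
pencil member shares a component with the cubic along the line at infinity).
Memo: HOME/work/s139/e13.md §9–§10, claim SB-C1092.
-/

namespace Summit.HodgeConjecture.HodgeConjecture.Theorems

open MvPolynomial

/-- Evaluation point `(1, 0)` of the plane. -/
def e13PointA (K : Type*) [CommRing K] : Fin 2 → K := fun i => if i = 0 then 1 else 0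

/-- Evaluation point `(0, 1)` of the plane. -/
def e13PointB (K : Type*) [CommRing K] : Fin 2 → K := fun i => if i = 0 then 0 else 1

/-- The cubic part `a b (a + b)` vanishes at `(1,0)`. -/
theorem eval_pointA_cubic {K : Type*} [CommRing K] :
    MvPolynomial.eval (e13PointA K) (X 0 * X 1 * (X 0 + X 1) : MvPolynomial (Fin 2) K) = 0 := by
  simp [e13PointA]

/-- The cubic part `a b (a + b)` vanishes at `(0,1)`. -/
theorem eval_pointB_cubic {K : Type*} [CommRing K] :
    MvPolynomial.eval (e13PointB K) (X 0 * X 1 * (X 0 + X 1) : MvPolynomial (Fin 2) K) = 0 := by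
  simp [e13PointB]

/-- The pencil part `c₁ a⁵ + c₂ b⁵` takes the value `c₁` at `(1,0)`. -/
theorem eval_pointA_quintic {K : Type*} [CommRing K] (c₁ c₂ : K) :
    MvPolynomial.eval (e13PointA K) (C c₁ * X 0 ^ 5 + C c₂ * X 1 ^ 5 : MvPolynomial (Fin 2) K)
      = c₁ := by
  simp [e13PointA]

/-- The pencil part `c₁ a⁵ + c₂ b⁵` takes the value `c₂` at `(0,1)`. -/
theorem eval_pointB_quintic {K : Type*} [CommRing K] (c₁ c₂ : K) :
    MvPolynomial.eval (e13PointB K) (C c₁ * X 0 ^ 5 + C c₂ * X 1 ^ 5 : MvPolynomial (Fin 2) K)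
      = c₂ := by
  simp [e13PointB]

/-- Step (α) of E13-THIRTEEN on the line at infinity: a degree-5 pencil part `c₁ a⁵ + c₂ b⁵`
divisible by the cubic part `a b (a + b)` of the separating function is zero. -/
theorem pencil_quintic_not_divisible {K : Type*} [CommRing K] (c₁ c₂ : K)
    (A : MvPolynomial (Fin 2) K)
    (h : (C c₁ * X 0 ^ 5 + C c₂ * X 1 ^ 5 : MvPolynomial (Fin 2) K)
      = A * (X 0 * X 1 * (X 0 + X 1))) :
    c₁ = 0 ∧ c₂ = 0 := by
  refine ⟨?_, ?_⟩
  · have hA := congrArg (MvPolynomial.eval (e13PointA K)) h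
    rw [eval_pointA_quintic, map_mul, eval_pointA_cubic, mul_zero] at hA
    exact hA
  · have hB := congrArg (MvPolynomial.eval (e13PointB K)) h
    rw [eval_pointB_quintic, map_mul, eval_pointB_cubic, mul_zero] at hB
    exact hB

/-- Consequently a nonzero pencil member (some `cᵢ ≠ 0`) is never a multiple of the cubic part. -/
theorem pencil_quintic_ne_mul {K : Type*} [CommRing K] (c₁ c₂ : K) (hc : c₁ ≠ 0 ∨ c₂ ≠ 0)
    (A : MvPolynomial (Fin 2) K) :
    (C c₁ * X 0 ^ 5 + C c₂ * X 1 ^ 5 : MvPolynomial (Fin 2) K)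
      ≠ A * (X 0 * X 1 * (X 0 + X 1)) := by
  intro h
  obtain ⟨h₁, h₂⟩ := pencil_quintic_not_divisible c₁ c₂ A h
  rcases hc with hc | hc
  · exact hc h₁
  · exact hc h₂

end Summit.HodgeConjecture.HodgeConjecture.Theorems
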